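import Literature.Computability.Cryptography.QuantumTuringMachineSweep
import HarnessLib

/-!
# Tracks of a sweep machine: anchored segments, and the list-level effect of push, pop, rotate, gather and return

Toolkit file, sequel of `QuantumTuringMachineSweep.lean` (generic oblivious sweep machines: one
pass of the head applies a (register, cell) rule to the live cells in order, i.e. the list scan
`QTM.scan`). The machines of the circuit-executor construction (Bernstein–Vazirani 1997, §4;
Nishimura–Ozawa 2002, Lemma 5.1) keep several *tracks* on the tape, each holding a stack or a
queue of symbols; this file fixes the symbol discipline of ONE track and proves, purely at the
level of lists, what the elementary track operations do under `QTM.scan`: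

* `QTM.Track.TSym α` — track symbols: `free`, or a *base* symbol (`anc` the anchor, `dead` a
  consumed queue cell, `hole` a parked qubit's place, `sym a` a data symbol) carrying a *hat* bit;
  a well-formed track is `pre ++ seg body ++ suf` with `pre`, `suf` free and
  `seg body = hatLast (anc :: body)`: the anchor, then the body, the LAST cell hatted (the hat
  marks the top of a stack / the back of a queue, or the anchor of an empty structure);
* the operations, each given as an injective PARTIAL rule on (micro-state, symbol)
  (`pushSpec`, `popSpec`, …; Bernstein–Vazirani 1997, App. B: reversible = one-to-one partial
  transition function) together with the list-level theorem for ANY total rule extending it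
  (`scan_push`, `scan_pop`, …):
  - **push** `a` (rightward pass): at the hatted cell drop the hat, write `sym a` hatted on the
    next (free) cell — `seg body ↦ seg (body ++ [sym a])`;
  - **pop** (leftward pass, list met in reverse): take the hatted top if it is a data symbol and
    hat the cell before — `seg (body ++ [sym a]) ↦ seg body`, reporting `some a`; an anchor- or
    dead-topped segment reports `none` and is unchanged;
  - **rotate** (rightward): move the first data symbol after the anchor and dead cells to the
    back — `seg (dead^d ++ sym a :: rest) ↦ seg (dead^(d+1) ++ rest ++ [sym a])`;
  - **gather** `k` (rightward): take the first `k` data symbols into the register, leaving holes;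
    **return** (leftward): put register symbols back into the holes.

Everything is proved; nothing here mentions machines. The sequel assembles tracks into the cells
of a `QTM.SweepSpec`.

## References

* E. Bernstein, U. Vazirani, *Quantum complexity theory*, SIAM J. Comput. 26 (1997) 1411–1473
  [BernsteinVaziraniSICOMP1997]: §4 (tracks, markers; Lemmas 4.4–4.13), App. B (Def. B.1).
* H. Nishimura, M. Ozawa, Theoret. Comput. Sci. 276 (2002) 147–181 [NishimuraOzawa2002]:
  Lemma 5.1 (the simulating machine keeps the qubits of the circuit on a track of its tape).
-/

namespace Literature.Computability.Cryptography

namespace QTM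

namespace Track

open SweepSpec (scan scan_nil scan_cons length_scan)

/-! ### Track symbols and anchored segments -/

/-- Base symbols of a track: the anchor of the structure, a dead (consumed) queue cell, a hole
(place of a parked qubit), a data symbol. [cite: BernsteinVaziraniSICOMP1997, §4] -/
inductive Base (α : Type) where
  | anc : Base α
  | dead : Base α
  | hole : Base α
  | sym (a : α) : Base α
  deriving DecidableEq

/-- Track symbols: a free cell, or a base symbol with a hat bit (the hat marks the last cell of
the structure: top of the stack / back of the queue / anchor of an empty structure). [cite: BernsteinVaziraniSICOMP1997, §4] -/
inductive TSym (α : Type) where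
  | free : TSym α
  | cell (b : Base α) (hat : Bool) : TSym α
  deriving DecidableEq

variable {α : Type}

namespace Base

/-- Coding of base symbols into a sum type (for finiteness). [folklore] -/
def equivSum : Base α ≃ Fin 3 ⊕ α where
  toFun
    | anc => Sum.inl 0
    | dead => Sum.inl 1
    | hole => Sum.inl 2
    | sym a => Sum.inr a
  invFun
    | Sum.inl 0 => anc
    | Sum.inl 1 => dead
    | Sum.inl 2 => hole
    | Sum.inr a => sym a
  left_inv x := by cases x <;> rfl
  right_inv x := by
    rcases x with i | a
    · fin_cases i <;> rfl
    · rfl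

/-- Base symbols over a finite alphabet are finite. [folklore] -/
instance [Fintype α] : Fintype (Base α) := Fintype.ofEquiv _ equivSum.symm

end Base

namespace TSym

/-- Coding of track symbols into a sum type (for finiteness). [folklore] -/
def equivOption : TSym α ≃ Option (Base α × Bool) where
  toFun
    | free => none
    | cell b h => some (b, h)
  invFun
    | none => free
    | some (b, h) => cell b h
  left_inv x := by cases x <;> rfl
  right_inv x := by rcases x with _ | ⟨b, h⟩ <;> rfl

/-- Track symbols over a finite alphabet are finite. [folklore] -/
instance [Fintype α] : Fintype (TSym α) := Fintype.ofEquiv _ equivOption.symm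

/-- The free cell is the default track symbol (blank tracks of pad cells). [folklore] -/
instance : Inhabited (TSym α) := ⟨free⟩

end TSym

open TSym Base

/-- Hat exactly the last symbol of a list of base symbols (all other hats down). [folklore] -/
def hatLast : List (Base α) → List (TSym α)
  | [] => []
  | [b] => [cell b true]
  | b :: b' :: bs => cell b false :: hatLast (b' :: bs)

/-- `hatLast` on a list with at least two elements. [folklore] -/
@[simp] theorem hatLast_cons_cons (b b' : Base α) (bs : List (Base α)) :
    hatLast (b :: b' :: bs) = cell b false :: hatLast (b' :: bs) := rfl

/-- `hatLast` of a singleton. [folklore] -/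
@[simp] theorem hatLast_singleton (b : Base α) : hatLast [b] = [cell b true] := rfl

/-- `hatLast` of a snoc: unhatted body, hatted last. [folklore] -/
theorem hatLast_append_singleton (bs : List (Base α)) (b : Base α) :
    hatLast (bs ++ [b]) = bs.map (cell · false) ++ [cell b true] := by
  induction bs with
  | nil => rfl
  | cons x xs ih =>
    cases xs with
    | nil => rfl
    | cons y ys => rw [List.cons_append, List.cons_append, hatLast_cons_cons, ← List.cons_append, ih]; rfl

/-- `hatLast` of a cons onto a non-empty list. [folklore] -/
theorem hatLast_cons_of_ne_nil (b : Base α) {bs : List (Base α)} (h : bs ≠ []) :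
    hatLast (b :: bs) = cell b false :: hatLast bs := by
  cases bs with
  | nil => exact absurd rfl h
  | cons => rfl

/-- `hatLast` preserves length. [folklore] -/
@[simp] theorem length_hatLast (bs : List (Base α)) : (hatLast bs).length = bs.length := by
  induction bs using List.reverseRecOn with
  | nil => rfl
  | append_singleton xs x _ => simp [hatLast_append_singleton]

/-- **The segment of an anchored structure** with body `body` (bottom/front first): the anchor,
the body, the last cell hatted. [cite: BernsteinVaziraniSICOMP1997, §4] -/
def seg (body : List (Base α)) : List (TSym α) := hatLast (anc :: body)

/-- The segment of the empty structure is the hatted anchor. [folklore] -/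
@[simp] theorem seg_nil : seg ([] : List (Base α)) = [cell anc true] := rfl

/-- The segment of a non-empty structure: unhatted anchor and body but for the hatted last cell. [folklore] -/
theorem seg_append_singleton (body : List (Base α)) (b : Base α) :
    seg (body ++ [b]) = cell anc false :: (body.map (cell · false) ++ [cell b true]) := by
  rw [seg, ← List.cons_append, hatLast_append_singleton]; rfl

/-- Length of a segment. [folklore] -/
@[simp] theorem length_seg (body : List (Base α)) : (seg body).length = body.length + 1 := by
  simp [seg]

/-- A run of free cells. [folklore] -/
abbrev frees (k : ℕ) : List (TSym α) := List.replicate k free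

/-! ### Scans: generic facts -/

section ScanGeneric

variable {Φ C : Type}

/-- Scanning a concatenation. [folklore] -/
theorem scan_append (r : Φ × C → Φ × C) (φ : Φ) (l₁ l₂ : List C) :
    scan r φ (l₁ ++ l₂) =
      ((scan r (scan r φ l₁).1 l₂).1, (scan r φ l₁).2 ++ (scan r (scan r φ l₁).1 l₂).2) := by
  induction l₁ generalizing φ with
  | nil => simp
  | cons x xs ih => simp [ih]

/-- Scanning cells on which the rule is the identity in the current register value. [folklore] -/
theorem scan_of_fixed (r : Φ × C → Φ × C) (φ : Φ) (l : List C) (h : ∀ c ∈ l, r (φ, c) = (φ, c)) :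
    scan r φ l = (φ, l) := by
  induction l with
  | nil => rfl
  | cons x xs ih =>
    rw [scan_cons, h x (by simp)]
    have := ih fun c hc => h c (by simp [hc])
    simp [this]

/-- Scanning a run of identical cells fixed by the rule. [folklore] -/
theorem scan_replicate_of_fixed (r : Φ × C → Φ × C) (φ : Φ) (c : C) (k : ℕ) (h : r (φ, c) = (φ, c)) :
    scan r φ (List.replicate k c) = (φ, List.replicate k c) :=
  scan_of_fixed r φ _ fun c' hc' => by rw [List.eq_of_mem_replicate hc']; exact h

/-- Scanning a list of cells each mapped without changing the register. [folklore] -/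
theorem scan_map_of_fixed (r : Φ × C → Φ × C) (φ : Φ) (l : List C) (f : C → C)
    (h : ∀ c ∈ l, r (φ, c) = (φ, f c)) : scan r φ l = (φ, l.map f) := by
  induction l with
  | nil => rfl
  | cons x xs ih =>
    rw [scan_cons, h x (by simp)]
    have := ih fun c hc => h c (by simp [hc])
    simp [this]

/-- A total rule `r` *extends* a partial rule `spec`: wherever `spec` is defined, `r` agrees. [cite: BernsteinVaziraniSICOMP1997, App. B (Def. B.1)] -/
def Extends (r : Φ × C → Φ × C) (spec : Φ × C → Option (Φ × C)) : Prop :=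
  ∀ x y, spec x = some y → r x = y

end ScanGeneric

/-! ### Push (rightward pass) -/

/-- Micro-states of a push: seeking the hatted cell, write pending, done. [cite: BernsteinVaziraniSICOMP1997, §4] -/
inductive PushSt where
  | seek | pend | done
  deriving DecidableEq, Fintype

/-- **The push rule** (partial): pass free and unhatted cells while seeking; at the hatted cell
drop the hat and remember that a write is pending; write the new hatted symbol on the next cell,
which is free; pass free cells once done. [cite: BernsteinVaziraniSICOMP1997, §4] -/
def pushSpec (a : α) : PushSt × TSym α → Option (PushSt × TSym α)
  | (PushSt.seek, free) => some (PushSt.seek, free)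
  | (PushSt.seek, cell b false) => some (PushSt.seek, cell b false)
  | (PushSt.seek, cell b true) => some (PushSt.pend, cell b false)
  | (PushSt.pend, free) => some (PushSt.done, cell (sym a) true)
  | (PushSt.done, free) => some (PushSt.done, free)
  | _ => none

/-- The push rule is one-to-one. [cite: BernsteinVaziraniSICOMP1997, App. B (Def. B.1)] -/
theorem pushSpec_injective (a : α) : PartialInjective (pushSpec a) := by
  rintro ⟨s₁, t₁⟩ ⟨s₂, t₂⟩ y h₁ h₂
  rcases s₁ with _ | _ | _ <;> rcases t₁ with _ | ⟨b₁, _ | _⟩ <;>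
    rcases s₂ with _ | _ | _ <;> rcases t₂ with _ | ⟨b₂, _ | _⟩ <;>
    simp only [pushSpec, Option.some.injEq, reduceCtorEq] at h₁ h₂ <;>
    subst h₁ <;> simp_all

/-- **Push, at the level of lists**: scanning `pre ++ seg body ++ free :: suf` (free `pre`, `suf`)
from `seek` with any rule extending `pushSpec a` ends in `done` with
`pre ++ seg (body ++ [sym a]) ++ suf`. [cite: BernsteinVaziraniSICOMP1997, §4] -/
theorem scan_push {r : PushSt × TSym α → PushSt × TSym α} {a : α} (hr : Extends r (pushSpec a))
    (j k : ℕ) (body : List (Base α)) :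
    scan r PushSt.seek (frees j ++ seg body ++ free :: frees k) =
      (PushSt.done, frees j ++ seg (body ++ [sym a]) ++ frees k) := by
  -- the segment: unhatted cells, then the hatted last cell, then the free cell receiving `a`
  have hseg : ∀ (bs : List (Base α)) (b : Base α),
      scan r PushSt.seek (bs.map (cell · false) ++ [cell b true] ++ free :: frees k) =
        (PushSt.done, bs.map (cell · false) ++ [cell b false] ++ cell (sym a) true :: frees k) := by
    intro bs b
    rw [List.append_assoc, scan_append,
      scan_map_of_fixed r PushSt.seek (bs.map (cell · false)) id (fun c hc => by
        obtain ⟨b', -, rfl⟩ := List.mem_map.1 hc; exact hr _ _ rfl)]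
    simp only [List.map_id, List.singleton_append, scan_cons]
    rw [hr _ _ (rfl : pushSpec a (PushSt.seek, cell b true) = _)]
    simp only
    rw [hr _ _ (rfl : pushSpec a (PushSt.pend, free) = _)]
    simp only
    rw [scan_replicate_of_fixed r _ _ k (hr _ _ rfl)]
    simp
  -- `anc :: body` is a snoc
  obtain ⟨bs, b, hb⟩ : ∃ (bs : List (Base α)) (b : Base α), anc :: body = bs ++ [b] :=
    ⟨(anc :: body).dropLast, (anc :: body).getLast (by simp), (List.dropLast_append_getLast _).symm⟩
  have h1 : seg body = bs.map (cell · false) ++ [cell b true] := by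
    rw [seg, hb, hatLast_append_singleton]
  have h2 : seg (body ++ [sym a]) = bs.map (cell · false) ++ [cell b false] ++ [cell (sym a) true] := by
    rw [seg, ← List.cons_append, hb, hatLast_append_singleton]
    simp
  -- the free prefix, then the segment
  rw [List.append_assoc, scan_append, scan_replicate_of_fixed r _ _ j (hr _ _ rfl)]
  simp only
  rw [h1, hseg bs b, h2]
  simp

/-! ### Pop (leftward pass; the track is met in reverse) -/

/-- Micro-states of a pop: seeking the hatted cell, having taken the symbol `a` (the hat is to
be put on the next cell), done with result `o` (`none`: the structure was empty). [cite: BernsteinVaziraniSICOMP1997, §4] -/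
inductive PopSt (α : Type) where
  | seek : PopSt α
  | took (a : α) : PopSt α
  | done (o : Option α) : PopSt α
  deriving DecidableEq

/-- **The pop rule** (partial), for the leftward pass (cells met right to left): pass free cells;
at the hatted cell, if it is a data symbol take it (the cell becomes free) and hat the next cell
met (the new top, or the anchor); if the hatted cell is the anchor or a dead cell the structure is
empty: report `none`; pass the remaining unhatted cells and the free cells. [cite: BernsteinVaziraniSICOMP1997, §4] -/
def popSpec : PopSt α × TSym α → Option (PopSt α × TSym α)
  | (PopSt.seek, free) => some (PopSt.seek, free)
  | (PopSt.seek, cell (sym a) true) => some (PopSt.took a, free)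
  | (PopSt.seek, cell anc true) => some (PopSt.done none, cell anc true)
  | (PopSt.seek, cell dead true) => some (PopSt.done none, cell dead true)
  | (PopSt.took a, cell b false) => some (PopSt.done (some a), cell b true)
  | (PopSt.done o, cell b false) => some (PopSt.done o, cell b false)
  | (PopSt.done o, free) => some (PopSt.done o, free)
  | _ => none

/-- A partial left inverse of the pop rule. [folklore] -/
def unpop : PopSt α × TSym α → Option (PopSt α × TSym α)
  | (PopSt.seek, free) => some (PopSt.seek, free)
  | (PopSt.took a, free) => some (PopSt.seek, cell (sym a) true)
  | (PopSt.done none, cell anc true) => some (PopSt.seek, cell anc true)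
  | (PopSt.done none, cell dead true) => some (PopSt.seek, cell dead true)
  | (PopSt.done (some a), cell b true) => some (PopSt.took a, cell b false)
  | (PopSt.done o, cell b false) => some (PopSt.done o, cell b false)
  | (PopSt.done o, free) => some (PopSt.done o, free)
  | _ => none

/-- `unpop` inverts `popSpec` on its domain. [folklore] -/
theorem unpop_of_popSpec {x y : PopSt α × TSym α} (h : popSpec x = some y) : unpop y = some x := by
  obtain ⟨s, t⟩ := x
  rcases s with _ | a | (_ | o) <;> rcases t with _ | ⟨_ | _ | _ | a', _ | _⟩ <;>
    simp only [popSpec, reduceCtorEq, Option.some.injEq] at h <;> subst h <;> rfl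

/-- The pop rule is one-to-one. [cite: BernsteinVaziraniSICOMP1997, App. B (Def. B.1)] -/
theorem popSpec_injective : PartialInjective (popSpec (α := α)) := fun _ _ _ hx hy =>
  Option.some.inj ((unpop_of_popSpec hx).symm.trans (unpop_of_popSpec hy))

/-- The reverse of a segment: hatted last cell first, then the unhatted cells, the anchor last. [folklore] -/
theorem reverse_seg_eq {body : List (Base α)} {bs : List (Base α)} {b : Base α} (hb : anc :: body = bs ++ [b]) :
    (seg body).reverse = cell b true :: bs.reverse.map (cell · false) := by
  rw [seg, hb, hatLast_append_singleton]
  simp [List.map_reverse]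

/-- **Pop, at the level of lists, data symbol on top**: scanning the reversed track
`(frees j ++ seg (body ++ [sym a]) ++ frees k).reverse` from `seek` with any rule extending
`popSpec` ends in `done (some a)` with the reversed track of `frees j ++ seg body ++ frees (k+1)`. [cite: BernsteinVaziraniSICOMP1997, §4] -/
theorem scan_pop_sym {r : PopSt α × TSym α → PopSt α × TSym α} (hr : Extends r popSpec)
    (j k : ℕ) (body : List (Base α)) (a : α) :
    scan r PopSt.seek ((frees j ++ seg (body ++ [sym a]) ++ frees k).reverse) =
      (PopSt.done (some a), (frees j ++ seg body ++ frees (k + 1)).reverse) := by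
  obtain ⟨bs, b, hb⟩ : ∃ (bs : List (Base α)) (b : Base α), anc :: body = bs ++ [b] :=
    ⟨(anc :: body).dropLast, (anc :: body).getLast (by simp), (List.dropLast_append_getLast _).symm⟩
  have hb' : anc :: (body ++ [sym a]) = (bs ++ [b]) ++ [sym a] := by rw [← hb]; rfl
  simp only [List.reverse_append, List.reverse_replicate, reverse_seg_eq hb', reverse_seg_eq hb,
    List.reverse_append, List.reverse_singleton, List.singleton_append, List.map_cons, List.append_assoc]
  rw [scan_append, scan_replicate_of_fixed r _ _ k (hr _ _ rfl)]
  simp only [List.cons_append, scan_cons]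
  rw [hr _ _ (rfl : popSpec (PopSt.seek, cell (sym a) true) = _)]
  simp only
  rw [hr _ _ (rfl : popSpec (PopSt.took a, cell b false) = _)]
  simp only
  rw [scan_append, scan_map_of_fixed r _ (bs.reverse.map (cell · false)) id (fun c hc => by
      obtain ⟨b', -, rfl⟩ := List.mem_map.1 hc; exact hr _ _ rfl)]
  simp only [List.map_id]
  rw [scan_replicate_of_fixed r _ _ j (hr _ _ rfl)]
  simp [List.replicate_succ', List.append_assoc]

/-- **Pop on an empty structure** (anchor hatted): nothing changes, the result is `none`. [cite: BernsteinVaziraniSICOMP1997, §4] -/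
theorem scan_pop_nil {r : PopSt α × TSym α → PopSt α × TSym α} (hr : Extends r popSpec) (j k : ℕ) :
    scan r PopSt.seek ((frees j ++ seg ([] : List (Base α)) ++ frees k).reverse) =
      (PopSt.done none, (frees j ++ seg ([] : List (Base α)) ++ frees k).reverse) := by
  simp only [seg_nil, List.reverse_append, List.reverse_replicate, List.reverse_singleton,
    List.singleton_append]
  rw [scan_append, scan_replicate_of_fixed r _ _ k (hr _ _ rfl)]
  simp only [scan_cons]
  rw [hr _ _ (rfl : popSpec (PopSt.seek, cell anc true) = _)]
  simp only
  rw [scan_replicate_of_fixed r _ _ j (hr _ _ rfl)]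

/-- **Pop on a dead-topped structure** (a consumed queue): nothing changes, the result is `none`. [cite: BernsteinVaziraniSICOMP1997, §4] -/
theorem scan_pop_dead {r : PopSt α × TSym α → PopSt α × TSym α} (hr : Extends r popSpec) (j k : ℕ)
    (body : List (Base α)) :
    scan r PopSt.seek ((frees j ++ seg (body ++ [dead]) ++ frees k).reverse) =
      (PopSt.done none, (frees j ++ seg (body ++ [dead]) ++ frees k).reverse) := by
  obtain ⟨bs, b, hb⟩ : ∃ (bs : List (Base α)) (b : Base α), anc :: body = bs ++ [b] :=
    ⟨(anc :: body).dropLast, (anc :: body).getLast (by simp), (List.dropLast_append_getLast _).symm⟩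
  have hb' : anc :: (body ++ [dead]) = (bs ++ [b]) ++ [dead] := by rw [← hb]; rfl
  simp only [List.reverse_append, List.reverse_replicate, reverse_seg_eq hb', List.reverse_append,
    List.reverse_singleton, List.singleton_append, List.map_cons, List.append_assoc]
  rw [scan_append, scan_replicate_of_fixed r _ _ k (hr _ _ rfl)]
  simp only [List.cons_append, scan_cons]
  rw [hr _ _ (rfl : popSpec (PopSt.seek, cell dead true) = _)]
  simp only
  rw [hr _ _ (rfl : popSpec (PopSt.done none, cell b false) = _)]
  simp only
  rw [scan_append, scan_map_of_fixed r _ (bs.reverse.map (cell · false)) id (fun c hc => by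
      obtain ⟨b', -, rfl⟩ := List.mem_map.1 hc; exact hr _ _ rfl)]
  simp only [List.map_id]
  rw [scan_replicate_of_fixed r _ _ j (hr _ _ rfl)]

/-! ### Rotate (rightward pass): the front of a queue goes to its back -/

/-- The body of a queue track: `d` dead (consumed) cells, then the queue `q`, front first. [cite: NishimuraOzawa2002, Lemma 5.1] -/
def qbody (d : ℕ) (q : List α) : List (Base α) := List.replicate d dead ++ q.map sym

/-- Micro-states of a rotation: seeking the front, carrying the front symbol `a` towards the
back, write of `a` pending (the back has been unhatted), done. [cite: BernsteinVaziraniSICOMP1997, §4] -/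
inductive RotSt (α : Type) where
  | seek : RotSt α
  | carry (a : α) : RotSt α
  | pend (a : α) : RotSt α
  | done : RotSt α
  deriving DecidableEq

/-- **The rotation rule** (partial): pass free cells, the anchor and dead cells; take the first
data symbol (its cell becomes dead) and carry it; pass data symbols; at the hatted back drop the
hat; write the carried symbol, hatted, on the next (free) cell; pass free cells. A singleton
queue (the front is hatted) is taken and written back at once. [cite: BernsteinVaziraniSICOMP1997, §4] -/
def rotSpec : RotSt α × TSym α → Option (RotSt α × TSym α)
  | (RotSt.seek, free) => some (RotSt.seek, free)
  | (RotSt.seek, cell anc false) => some (RotSt.seek, cell anc false)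
  | (RotSt.seek, cell dead false) => some (RotSt.seek, cell dead false)
  | (RotSt.seek, cell (sym a) false) => some (RotSt.carry a, cell dead false)
  | (RotSt.seek, cell (sym a) true) => some (RotSt.pend a, cell dead false)
  | (RotSt.carry a, cell (sym x) false) => some (RotSt.carry a, cell (sym x) false)
  | (RotSt.carry a, cell (sym x) true) => some (RotSt.pend a, cell (sym x) false)
  | (RotSt.pend a, free) => some (RotSt.done, cell (sym a) true)
  | (RotSt.done, free) => some (RotSt.done, free)
  | _ => none

/-- A partial left inverse of the rotation rule. [folklore] -/
def unrot : RotSt α × TSym α → Option (RotSt α × TSym α)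
  | (RotSt.seek, free) => some (RotSt.seek, free)
  | (RotSt.seek, cell anc false) => some (RotSt.seek, cell anc false)
  | (RotSt.seek, cell dead false) => some (RotSt.seek, cell dead false)
  | (RotSt.carry a, cell dead false) => some (RotSt.seek, cell (sym a) false)
  | (RotSt.pend a, cell dead false) => some (RotSt.seek, cell (sym a) true)
  | (RotSt.carry a, cell (sym x) false) => some (RotSt.carry a, cell (sym x) false)
  | (RotSt.pend a, cell (sym x) false) => some (RotSt.carry a, cell (sym x) true)
  | (RotSt.done, cell (sym a) true) => some (RotSt.pend a, free)
  | (RotSt.done, free) => some (RotSt.done, free)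
  | _ => none

/-- `unrot` inverts `rotSpec` on its domain. [folklore] -/
theorem unrot_of_rotSpec {x y : RotSt α × TSym α} (h : rotSpec x = some y) : unrot y = some x := by
  obtain ⟨s, t⟩ := x
  rcases s with _ | a | a | _ <;> rcases t with _ | ⟨_ | _ | _ | a', _ | _⟩ <;>
    simp only [rotSpec, reduceCtorEq, Option.some.injEq] at h <;> subst h <;> rfl

/-- The rotation rule is one-to-one. [cite: BernsteinVaziraniSICOMP1997, App. B (Def. B.1)] -/
theorem rotSpec_injective : PartialInjective (rotSpec (α := α)) := fun _ _ _ hx hy =>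
  Option.some.inj ((unrot_of_rotSpec hx).symm.trans (unrot_of_rotSpec hy))

/-- The segment of a queue with at least two elements in front-explicit form. [folklore] -/
theorem seg_qbody_cons_append_singleton (d : ℕ) (a : α) (mid : List α) (z : α) :
    seg (qbody d (a :: (mid ++ [z]))) =
      cell anc false :: (List.replicate d (cell dead false) ++ cell (sym a) false ::
        (mid.map (fun x => cell (sym x) false) ++ [cell (sym z) true])) := by
  have : anc :: qbody d (a :: (mid ++ [z])) = (anc :: (List.replicate d dead ++ sym a :: mid.map sym)) ++ [sym z] := by
    simp [qbody, List.map_append]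
  rw [seg, this, hatLast_append_singleton]
  simp [List.map_append, List.map_replicate]

/-- **Rotate, at the level of lists, queue with at least two elements**:
`seg (dead^d, a, rest) ↦ seg (dead^(d+1), rest, a)` consuming one free cell on the right. [cite: BernsteinVaziraniSICOMP1997, §4] -/
theorem scan_rot_cons {r : RotSt α × TSym α → RotSt α × TSym α} (hr : Extends r rotSpec)
    (j k d : ℕ) (a : α) (rest : List α) (hrest : rest ≠ []) :
    scan r RotSt.seek (frees j ++ seg (qbody d (a :: rest)) ++ free :: frees k) =
      (RotSt.done, frees j ++ seg (qbody (d + 1) (rest ++ [a])) ++ frees k) := by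
  obtain ⟨mid, z, rfl⟩ : ∃ mid z, rest = mid ++ [z] :=
    ⟨rest.dropLast, rest.getLast hrest, (List.dropLast_append_getLast hrest).symm⟩
  have hout : seg (qbody (d + 1) (mid ++ [z] ++ [a])) =
      cell anc false :: (List.replicate d (cell dead false) ++ cell dead false ::
        (mid.map (fun x => cell (sym x) false) ++ [cell (sym z) false] ++ [cell (sym a) true])) := by
    have : anc :: qbody (d + 1) (mid ++ [z] ++ [a]) =
        (anc :: (List.replicate d dead ++ dead :: (mid.map sym ++ [sym z]))) ++ [sym a] := by
      simp [qbody, List.map_append, List.replicate_succ', List.append_assoc]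
    rw [seg, this, hatLast_append_singleton]
    simp [List.map_append, List.map_replicate, List.append_assoc]
  rw [List.append_assoc, scan_append, scan_replicate_of_fixed r _ _ j (hr _ _ rfl)]
  simp only
  rw [seg_qbody_cons_append_singleton, List.cons_append, scan_cons, hr _ _ (rfl : rotSpec (RotSt.seek, cell anc false) = _)]
  simp only
  rw [List.append_assoc, scan_append, scan_replicate_of_fixed r _ _ d (hr _ _ rfl)]
  simp only [List.cons_append, scan_cons]
  rw [hr _ _ (rfl : rotSpec (RotSt.seek, cell (sym a) false) = _)]
  simp only
  rw [List.append_assoc, scan_append,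
    scan_map_of_fixed r (RotSt.carry a) (mid.map fun x => cell (sym x) false) id (fun c hc => by
      obtain ⟨x, -, rfl⟩ := List.mem_map.1 hc; exact hr _ _ rfl)]
  simp only [List.map_id, List.singleton_append, scan_cons]
  rw [hr _ _ (rfl : rotSpec (RotSt.carry a, cell (sym z) true) = _)]
  simp only
  rw [hr _ _ (rfl : rotSpec (RotSt.pend a, free) = _)]
  simp only
  rw [scan_replicate_of_fixed r _ _ k (hr _ _ rfl), hout]
  simp [List.append_assoc]

/-- **Rotate a singleton queue**: `seg (dead^d, a) ↦ seg (dead^(d+1), a)`. [cite: BernsteinVaziraniSICOMP1997, §4] -/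
theorem scan_rot_singleton {r : RotSt α × TSym α → RotSt α × TSym α} (hr : Extends r rotSpec)
    (j k d : ℕ) (a : α) :
    scan r RotSt.seek (frees j ++ seg (qbody d [a]) ++ free :: frees k) =
      (RotSt.done, frees j ++ seg (qbody (d + 1) [a]) ++ frees k) := by
  have hin : seg (qbody d [a]) = cell anc false :: (List.replicate d (cell dead false) ++ [cell (sym a) true]) := by
    have : anc :: qbody d [a] = (anc :: List.replicate d dead) ++ [sym a] := by simp [qbody]
    rw [seg, this, hatLast_append_singleton]; simp [List.map_replicate]
  have hout : seg (qbody (d + 1) [a]) =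
      cell anc false :: (List.replicate d (cell dead false) ++ [cell dead false] ++ [cell (sym a) true]) := by
    have : anc :: qbody (d + 1) [a] = (anc :: (List.replicate d dead ++ [dead])) ++ [sym a] := by
      simp [qbody, List.replicate_succ']
    rw [seg, this, hatLast_append_singleton]; simp [List.map_replicate]
  rw [List.append_assoc, scan_append, scan_replicate_of_fixed r _ _ j (hr _ _ rfl)]
  simp only
  rw [hin, List.cons_append, scan_cons, hr _ _ (rfl : rotSpec (RotSt.seek, cell anc false) = _)]
  simp only
  rw [List.append_assoc, scan_append, scan_replicate_of_fixed r _ _ d (hr _ _ rfl)]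
  simp only [List.singleton_append, scan_cons]
  rw [hr _ _ (rfl : rotSpec (RotSt.seek, cell (sym a) true) = _)]
  simp only
  rw [hr _ _ (rfl : rotSpec (RotSt.pend a, free) = _)]
  simp only
  rw [scan_replicate_of_fixed r _ _ k (hr _ _ rfl), hout]
  simp [List.append_assoc]

/-! ### Gather (rightward pass): the first `k` data symbols go into the register, leaving holes -/

/-- **The gather rule** for `k` symbols (partial; micro-state = the symbols gathered so far,
front first): pass free cells, the anchor and dead cells; turn the first `k` data symbols into
holes (keeping their hats) while appending them to the register; pass the remaining data
symbols. [cite: NishimuraOzawa2002, Lemma 5.1] -/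
def gathSpec (k : ℕ) : List α × TSym α → Option (List α × TSym α)
  | (acc, free) => some (acc, free)
  | (acc, cell anc h) => some (acc, cell anc h)
  | (acc, cell dead h) => some (acc, cell dead h)
  | (acc, cell (sym a) h) =>
      if acc.length < k then some (acc ++ [a], cell hole h) else some (acc, cell (sym a) h)
  | _ => none

/-- A partial left inverse of the gather rule. [folklore] -/
def ungath (k : ℕ) : List α × TSym α → Option (List α × TSym α)
  | (acc, free) => some (acc, free)
  | (acc, cell anc h) => some (acc, cell anc h)
  | (acc, cell dead h) => some (acc, cell dead h)
  | (acc, cell hole h) =>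
      match acc.getLast? with
      | none => none
      | some a => if acc.dropLast.length < k then some (acc.dropLast, cell (sym a) h) else none
  | (acc, cell (sym a) h) => if acc.length < k then none else some (acc, cell (sym a) h)

/-- `ungath` inverts `gathSpec` on its domain. [folklore] -/
theorem ungath_of_gathSpec (k : ℕ) {x y : List α × TSym α} (h : gathSpec k x = some y) : ungath k y = some x := by
  obtain ⟨acc, t⟩ := x
  rcases t with _ | ⟨_ | _ | _ | a, h'⟩ <;> simp only [gathSpec, reduceCtorEq, Option.some.injEq] at h
  · subst h; rfl
  · subst h; rfl
  · subst h; rfl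
  · split_ifs at h with hlt
    · cases h
      simp [ungath, List.getLast?_append, hlt]
    · cases h
      simp [ungath, hlt]

/-- The gather rule is one-to-one. [cite: BernsteinVaziraniSICOMP1997, App. B (Def. B.1)] -/
theorem gathSpec_injective (k : ℕ) : PartialInjective (gathSpec (α := α) k) := fun _ _ _ hx hy =>
  Option.some.inj ((ungath_of_gathSpec k hx).symm.trans (ungath_of_gathSpec k hy))

/-! ### Hat annotations -/

/-- The hat annotation of a list of base symbols: all hats down but the last. [folklore] -/
def annot : List (Base α) → List (Base α × Bool)
  | [] => []
  | [b] => [(b, true)]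
  | b :: b' :: bs => (b, false) :: annot (b' :: bs)

/-- Cells of annotated base symbols. [folklore] -/
def cellsOf (ps : List (Base α × Bool)) : List (TSym α) := ps.map fun p => cell p.1 p.2

/-- `cellsOf` of a concatenation. [folklore] -/
@[simp] theorem cellsOf_append (ps qs : List (Base α × Bool)) : cellsOf (ps ++ qs) = cellsOf ps ++ cellsOf qs := by
  simp [cellsOf]

/-- `cellsOf` of a cons. [folklore] -/
@[simp] theorem cellsOf_cons (p : Base α × Bool) (ps : List (Base α × Bool)) :
    cellsOf (p :: ps) = cell p.1 p.2 :: cellsOf ps := rfl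

/-- `cellsOf []`. [folklore] -/
@[simp] theorem cellsOf_nil : cellsOf ([] : List (Base α × Bool)) = [] := rfl

/-- `hatLast` is `cellsOf ∘ annot`. [folklore] -/
theorem hatLast_eq_cellsOf_annot (bs : List (Base α)) : hatLast bs = cellsOf (annot bs) := by
  induction bs with
  | nil => rfl
  | cons b bs ih =>
    cases bs with
    | nil => rfl
    | cons b' bs' => rw [hatLast_cons_cons, ih]; rfl

/-- Annotation of a snoc. [folklore] -/
theorem annot_append_singleton (bs : List (Base α)) (b : Base α) :
    annot (bs ++ [b]) = bs.map (·, false) ++ [(b, true)] := by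
  induction bs with
  | nil => rfl
  | cons x xs ih =>
    cases xs with
    | nil => rfl
    | cons y ys => rw [List.cons_append, List.cons_append, annot, ← List.cons_append, ih]; rfl

/-- Annotation of a concatenation with a non-empty right part. [folklore] -/
theorem annot_append_of_ne_nil (xs : List (Base α)) {ys : List (Base α)} (h : ys ≠ []) :
    annot (xs ++ ys) = xs.map (·, false) ++ annot ys := by
  obtain ⟨ys', y, rfl⟩ : ∃ ys' y, ys = ys' ++ [y] :=
    ⟨ys.dropLast, ys.getLast h, (List.dropLast_append_getLast h).symm⟩
  rw [← List.append_assoc, annot_append_singleton, annot_append_singleton]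
  simp

/-- Annotation commutes with maps of the base symbols. [folklore] -/
theorem annot_map {β : Type} (f : Base β → Base α) (bs : List (Base β)) :
    annot (bs.map f) = (annot bs).map (fun p => (f p.1, p.2)) := by
  induction bs using List.reverseRecOn with
  | nil => rfl
  | append_singleton xs x _ => rw [List.map_append, List.map_singleton, annot_append_singleton, annot_append_singleton]; simp

/-- The segment as cells of an annotation. [folklore] -/
theorem seg_eq_cellsOf (body : List (Base α)) : seg body = cellsOf (annot (anc :: body)) :=
  hatLast_eq_cellsOf_annot _

/-- The data cells of annotated data symbols. [folklore] -/
def symCells (ps : List (α × Bool)) : List (TSym α) := ps.map fun p => cell (sym p.1) p.2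

/-- The hole cells left by annotated data symbols. [folklore] -/
def holeCells (ps : List (α × Bool)) : List (TSym α) := ps.map fun p => cell hole p.2

/-- `symCells []`. [folklore] -/
@[simp] theorem symCells_nil : symCells ([] : List (α × Bool)) = [] := rfl
/-- `symCells` of a cons. [folklore] -/
@[simp] theorem symCells_cons (p : α × Bool) (ps : List (α × Bool)) :
    symCells (p :: ps) = cell (sym p.1) p.2 :: symCells ps := rfl
/-- `symCells` of a concatenation. [folklore] -/
@[simp] theorem symCells_append (ps qs : List (α × Bool)) : symCells (ps ++ qs) = symCells ps ++ symCells qs := by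
  simp [symCells]
/-- `holeCells []`. [folklore] -/
@[simp] theorem holeCells_nil : holeCells ([] : List (α × Bool)) = [] := rfl
/-- `holeCells` of a cons. [folklore] -/
@[simp] theorem holeCells_cons (p : α × Bool) (ps : List (α × Bool)) :
    holeCells (p :: ps) = cell hole p.2 :: holeCells ps := rfl
/-- `holeCells` of a concatenation. [folklore] -/
@[simp] theorem holeCells_append (ps qs : List (α × Bool)) : holeCells (ps ++ qs) = holeCells ps ++ holeCells qs := by
  simp [holeCells]
/-- Length of `symCells`. [folklore] -/
@[simp] theorem length_symCells (ps : List (α × Bool)) : (symCells ps).length = ps.length := by simp [symCells]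
/-- Length of `holeCells`. [folklore] -/
@[simp] theorem length_holeCells (ps : List (α × Bool)) : (holeCells ps).length = ps.length := by simp [holeCells]

/-- The annotation of a list of data symbols. [folklore] -/
def annotSyms (q : List α) : List (α × Bool) := q.dropLast.map (·, false) ++ (q.getLast?.toList.map (·, true))

/-- `annotSyms` of a snoc. [folklore] -/
theorem annotSyms_append_singleton (q : List α) (z : α) :
    annotSyms (q ++ [z]) = q.map (·, false) ++ [(z, true)] := by
  simp [annotSyms, List.getLast?_append]

/-- The values of `annotSyms q` are `q`. [folklore] -/
@[simp] theorem map_fst_annotSyms (q : List α) : (annotSyms q).map Prod.fst = q := by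
  induction q using List.reverseRecOn with
  | nil => rfl
  | append_singleton xs x _ => simp [annotSyms_append_singleton, Function.comp_def]

/-- Length of `annotSyms`. [folklore] -/
@[simp] theorem length_annotSyms (q : List α) : (annotSyms q).length = q.length := by
  rw [← List.length_map (f := Prod.fst), map_fst_annotSyms]

/-- Cells of the annotation of mapped data symbols are `symCells ∘ annotSyms`. [folklore] -/
theorem cellsOf_annot_map_sym (q : List α) : cellsOf (annot (q.map sym)) = symCells (annotSyms q) := by
  induction q using List.reverseRecOn with
  | nil => rfl
  | append_singleton xs x _ =>
    rw [List.map_append, List.map_singleton, annot_append_singleton, annotSyms_append_singleton]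
    simp [cellsOf, symCells]

/-- **The segment of a queue body with a non-empty queue**: anchor, dead cells, then the data
cells with the hat on the last. [cite: NishimuraOzawa2002, Lemma 5.1] -/
theorem seg_qbody_of_ne_nil (d : ℕ) {q : List α} (hq : q ≠ []) :
    seg (qbody d q) = cell anc false :: (List.replicate d (cell dead false) ++ symCells (annotSyms q)) := by
  rw [seg_eq_cellsOf, qbody, ← List.cons_append, annot_append_of_ne_nil _ (by simpa using hq),
    cellsOf_append, cellsOf_annot_map_sym]
  simp [cellsOf, List.map_replicate]

/-- **The segment of a gathered queue body** (`d` dead cells, `m` holes, then the rest `rest`,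
non-empty): anchor, dead cells, unhatted holes, the data cells of `rest`. [cite: NishimuraOzawa2002, Lemma 5.1] -/
theorem seg_gathered_of_ne_nil (d m : ℕ) {rest : List α} (hrest : rest ≠ []) :
    seg (List.replicate d dead ++ List.replicate m hole ++ rest.map sym) =
      cell anc false :: (List.replicate d (cell dead false) ++ List.replicate m (cell hole false) ++
        symCells (annotSyms rest)) := by
  rw [seg_eq_cellsOf, ← List.cons_append, ← List.cons_append, annot_append_of_ne_nil _ (by simpa using hrest),
    cellsOf_append, cellsOf_annot_map_sym]
  simp [cellsOf, List.map_replicate]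

/-- **The segment of a fully gathered queue body** (`d` dead cells, `m + 1` holes, nothing else):
the last hole is hatted. [cite: NishimuraOzawa2002, Lemma 5.1] -/
theorem seg_gathered_nil (d m : ℕ) :
    seg (List.replicate d dead ++ List.replicate (m + 1) hole ++ ([] : List α).map sym) =
      cell anc false :: (List.replicate d (cell dead false) ++ List.replicate m (cell hole false) ++
        [cell hole true]) := by
  rw [List.map_nil, List.append_nil, seg_eq_cellsOf, List.replicate_succ', ← List.append_assoc,
    ← List.cons_append, annot_append_singleton]
  simp [cellsOf, List.map_replicate]

/-! ### Gather, at the level of lists -/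

/-- Gathering over a zone of data cells: the first `k - |acc|` values are appended to the
register and their cells become holes (hats kept), the rest is unchanged. [cite: NishimuraOzawa2002, Lemma 5.1] -/
theorem scan_gath_symCells {r : List α × TSym α → List α × TSym α} {k : ℕ} (hr : Extends r (gathSpec k))
    (ps : List (α × Bool)) (acc : List α) :
    scan r acc (symCells ps) =
      (acc ++ ((ps.take (k - acc.length)).map Prod.fst),
        holeCells (ps.take (k - acc.length)) ++ symCells (ps.drop (k - acc.length))) := by
  induction ps generalizing acc with
  | nil => simp
  | cons p ps ih =>
    rw [symCells_cons, scan_cons]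
    by_cases hlt : acc.length < k
    · rw [hr _ _ (by simp [gathSpec, hlt] : gathSpec k (acc, cell (sym p.1) p.2) = some (acc ++ [p.1], cell hole p.2))]
      simp only
      rw [ih (acc ++ [p.1])]
      obtain ⟨m, hm⟩ : ∃ m, k - acc.length = m + 1 := ⟨k - acc.length - 1, by omega⟩
      have hm' : k - (acc ++ [p.1]).length = m := by simp; omega
      rw [hm, hm']
      simp
    · rw [hr _ _ (by simp [gathSpec, hlt] : gathSpec k (acc, cell (sym p.1) p.2) = some (acc, cell (sym p.1) p.2))]
      simp only
      rw [ih acc]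
      have h0 : k - acc.length = 0 := by omega
      simp [h0]

/-- **Gather, at the level of lists** (`0 < k < |q|`): the first `k` queue symbols go into the
register, their cells become (unhatted) holes. [cite: NishimuraOzawa2002, Lemma 5.1] -/
theorem scan_gath_lt {r : List α × TSym α → List α × TSym α} {k : ℕ} (hr : Extends r (gathSpec k))
    (j k' d : ℕ) (q : List α) (hk : k < q.length) :
    scan r [] (frees j ++ seg (qbody d q) ++ frees k') =
      (q.take k, frees j ++ seg (List.replicate d dead ++ List.replicate k hole ++ (q.drop k).map sym) ++ frees k') := by
  have hq : q ≠ [] := by rintro rfl; simp at hk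
  have hrest : q.drop k ≠ [] := by
    intro h; have := List.drop_eq_nil_iff.1 h; omega
  rw [seg_qbody_of_ne_nil d hq, seg_gathered_of_ne_nil d k hrest]
  rw [List.append_assoc, scan_append, scan_replicate_of_fixed r _ _ j (hr _ _ rfl)]
  simp only [List.cons_append, scan_cons]
  rw [hr _ _ (rfl : gathSpec k ([], cell anc false) = _)]
  simp only [List.append_assoc]
  rw [scan_append, scan_replicate_of_fixed r _ _ d (hr _ _ rfl)]
  simp only
  rw [scan_append, scan_gath_symCells hr]
  simp only [List.length_nil, Nat.sub_zero, List.nil_append]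
  rw [scan_replicate_of_fixed r _ _ k' (hr _ _ (by simp [gathSpec]))]
  -- identify the pieces
  have htake : ((annotSyms q).take k).map Prod.fst = q.take k := by
    rw [List.map_take, map_fst_annotSyms]
  obtain ⟨q', z, rfl⟩ : ∃ q' z, q = q' ++ [z] := ⟨q.dropLast, q.getLast hq, (List.dropLast_append_getLast hq).symm⟩
  have hk' : k ≤ q'.length := by simp at hk; omega
  have htake2 : (annotSyms (q' ++ [z])).take k = (q'.take k).map (·, false) := by
    rw [annotSyms_append_singleton, List.take_append_of_le_length (by simpa using hk'), List.map_take]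
  have hdrop2 : (annotSyms (q' ++ [z])).drop k = annotSyms ((q' ++ [z]).drop k) := by
    rw [annotSyms_append_singleton, List.drop_append_of_le_length (by simpa using hk'),
      List.drop_append_of_le_length hk', annotSyms_append_singleton, List.map_drop]
  rw [htake, htake2, hdrop2]
  simp [holeCells, List.append_assoc, Function.comp_def, List.take_replicate, min_eq_left hk']

/-- **Gather the whole queue** (`k = |q| > 0`): all symbols go into the register, the last hole
is hatted. [cite: NishimuraOzawa2002, Lemma 5.1] -/
theorem scan_gath_all {r : List α × TSym α → List α × TSym α} {k : ℕ} (hr : Extends r (gathSpec k))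
    (j k' d : ℕ) (q : List α) (hk : k = q.length) (hq : q ≠ []) :
    scan r [] (frees j ++ seg (qbody d q) ++ frees k') =
      (q, frees j ++ seg (List.replicate d dead ++ List.replicate k hole ++ ([] : List α).map sym) ++ frees k') := by
  obtain ⟨m, hm⟩ : ∃ m, k = m + 1 := ⟨k - 1, by cases q with | nil => exact absurd rfl hq | cons => simp at hk; omega⟩
  rw [seg_qbody_of_ne_nil d hq, hm, seg_gathered_nil d m]
  rw [List.append_assoc, scan_append, scan_replicate_of_fixed r _ _ j (hr _ _ rfl)]
  simp only [List.cons_append, scan_cons]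
  rw [hr _ _ (rfl : gathSpec k ([], cell anc false) = _)]
  simp only [List.append_assoc]
  rw [scan_append, scan_replicate_of_fixed r _ _ d (hr _ _ rfl)]
  simp only
  rw [scan_append, scan_gath_symCells hr]
  simp only [List.length_nil, Nat.sub_zero, List.nil_append]
  have hlen : (annotSyms q).length = k := by simp [hk]
  rw [List.take_of_length_le (by omega), List.drop_of_length_le (by omega),
    scan_replicate_of_fixed r _ _ k' (hr _ _ (by simp [gathSpec]))]
  obtain ⟨q', z, rfl⟩ : ∃ q' z, q = q' ++ [z] := ⟨q.dropLast, q.getLast hq, (List.dropLast_append_getLast hq).symm⟩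
  have hm' : q'.length = m := by simp at hk; omega
  rw [map_fst_annotSyms, annotSyms_append_singleton]
  simp [holeCells, List.append_assoc, Function.comp_def, hm']

/-! ### Return (leftward pass): the register symbols go back into the holes -/

/-- **The return rule** for `k` symbols (partial; micro-state = the symbols still to be returned,
the last one returned first), for the leftward pass: pass free cells and — while all `k` symbols
are still held — data cells (the back of the queue); put the last held symbol into each hole met
(keeping the hat); once empty-handed pass dead cells and the anchor. [cite: NishimuraOzawa2002, Lemma 5.1] -/
def retSpec (k : ℕ) : List α × TSym α → Option (List α × TSym α)
  | (l, free) => some (l, free)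
  | (l, cell (sym x) h) => if l.length = k then some (l, cell (sym x) h) else none
  | (l, cell hole h) =>
      match l.getLast? with
      | none => none
      | some a => if l.length ≤ k then some (l.dropLast, cell (sym a) h) else none
  | ([], cell dead h) => some ([], cell dead h)
  | ([], cell anc h) => some ([], cell anc h)
  | _ => none

/-- A partial left inverse of the return rule. [folklore] -/
def unret (k : ℕ) : List α × TSym α → Option (List α × TSym α)
  | (l, free) => some (l, free)
  | (l, cell (sym a) h) =>
      if l.length = k then some (l, cell (sym a) h)
      else if l.length < k then some (l ++ [a], cell hole h) else none
  | ([], cell dead h) => some ([], cell dead h)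
  | ([], cell anc h) => some ([], cell anc h)
  | _ => none

/-- `unret` inverts `retSpec` on its domain. [folklore] -/
theorem unret_of_retSpec (k : ℕ) {x y : List α × TSym α} (h : retSpec k x = some y) : unret k y = some x := by
  obtain ⟨l, t⟩ := x
  rcases t with _ | ⟨_ | _ | _ | a, h'⟩
  · simp only [retSpec, Option.some.injEq] at h; subst h; rfl
  · cases l with
    | nil => simp only [retSpec, Option.some.injEq] at h; subst h; rfl
    | cons => simp [retSpec] at h
  · cases l with
    | nil => simp only [retSpec, Option.some.injEq] at h; subst h; rfl
    | cons => simp [retSpec] at h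
  · simp only [retSpec] at h
    cases hl : l.getLast? with
    | none => rw [hl] at h; simp at h
    | some b =>
      rw [hl] at h
      simp only at h
      split_ifs at h with hle
      cases h
      have hne : l ≠ [] := by rintro rfl; simp at hl
      have hlast : l.dropLast ++ [b] = l := by
        rw [List.getLast?_eq_getLast_of_ne_nil hne, Option.some.injEq] at hl
        rw [← hl, List.dropLast_append_getLast hne]
      have hpos := List.length_pos_of_ne_nil hne
      have h1 : l.length - 1 ≠ k := by omega
      have h2 : l.length - 1 < k := by omega
      simp [unret, h1, h2, hlast]
  · simp only [retSpec] at h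
    split_ifs at h with hlk
    cases h
    simp [unret, hlk]

/-- The return rule is one-to-one. [cite: BernsteinVaziraniSICOMP1997, App. B (Def. B.1)] -/
theorem retSpec_injective (k : ℕ) : PartialInjective (retSpec (α := α) k) := fun _ _ _ hx hy =>
  Option.some.inj ((unret_of_retSpec k hx).symm.trans (unret_of_retSpec k hy))

/-- `annotSyms` of a concatenation with a non-empty right part. [folklore] -/
theorem annotSyms_append_of_ne_nil (p : List α) {q : List α} (hq : q ≠ []) :
    annotSyms (p ++ q) = p.map (·, false) ++ annotSyms q := by
  obtain ⟨q', z, rfl⟩ : ∃ q' z, q = q' ++ [z] := ⟨q.dropLast, q.getLast hq, (List.dropLast_append_getLast hq).symm⟩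
  rw [← List.append_assoc, annotSyms_append_singleton, annotSyms_append_singleton]
  simp

/-- Returning over a run of unhatted holes: the held symbols are deposited, last one first. [cite: NishimuraOzawa2002, Lemma 5.1] -/
theorem scan_ret_holes {r : List α × TSym α → List α × TSym α} {k : ℕ} (hr : Extends r (retSpec k))
    (l : List α) (hl : l.length ≤ k) :
    scan r l (List.replicate l.length (cell hole false)) = ([], (l.map fun a => cell (sym a) false).reverse) := by
  induction l using List.reverseRecOn with
  | nil => rfl
  | append_singleton xs x ih =>
    have h1 : xs.length + 1 ≤ k := by simpa using hl
    rw [List.length_append, List.length_singleton, List.replicate_succ, scan_cons,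
      hr _ _ (by simp [retSpec, List.getLast?_append, h1] :
        retSpec k (xs ++ [x], cell hole false) = some (xs, cell (sym x) false))]
    simp only
    rw [ih (by omega)]
    simp

/-- Passing over the data cells at the back while holding all `k` symbols. [folklore] -/
theorem scan_ret_symCells {r : List α × TSym α → List α × TSym α} {k : ℕ} (hr : Extends r (retSpec k))
    (l : List α) (hl : l.length = k) (ps : List (α × Bool)) : scan r l (symCells ps) = (l, symCells ps) := by
  refine scan_of_fixed r l _ fun c hc => ?_
  obtain ⟨p, -, rfl⟩ := List.mem_map.1 hc
  exact hr _ _ (by simp [retSpec, hl])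

/-- **Return, at the level of lists** (the queue keeps a non-empty rest `rest` behind the holes):
scanning the reversed track of `seg (dead^d ++ hole^k ++ rest)` holding `parked` (`|parked| = k`)
ends empty-handed with the reversed track of `seg (qbody d (parked ++ rest))`. [cite: NishimuraOzawa2002, Lemma 5.1] -/
theorem scan_ret_of_ne_nil {r : List α × TSym α → List α × TSym α} {k : ℕ} (hr : Extends r (retSpec k))
    (j k' d : ℕ) (parked rest : List α) (hpk : parked.length = k) (hrest : rest ≠ []) :
    scan r parked ((frees j ++ seg (List.replicate d dead ++ List.replicate k hole ++ rest.map sym) ++ frees k').reverse) =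
      ([], (frees j ++ seg (qbody d (parked ++ rest)) ++ frees k').reverse) := by
  rw [seg_gathered_of_ne_nil d k hrest, seg_qbody_of_ne_nil d (by simp [hrest] : parked ++ rest ≠ []),
    annotSyms_append_of_ne_nil _ hrest, symCells_append]
  simp only [List.reverse_append, List.reverse_cons, List.reverse_replicate, List.append_assoc,
    List.singleton_append]
  -- frees k'
  rw [scan_append, scan_replicate_of_fixed r _ _ k' (hr _ _ rfl)]
  simp only
  -- the back data cells (reversed)
  have hsym : (symCells (annotSyms rest)).reverse = symCells (annotSyms rest).reverse := by
    simp [symCells, List.map_reverse]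
  rw [hsym, scan_append, scan_ret_symCells hr parked hpk]
  simp only
  -- the holes
  have hholes := scan_ret_holes hr parked (by omega)
  rw [hpk] at hholes
  rw [scan_append, hholes]
  simp only
  -- dead cells, anchor, frees j
  rw [scan_append, scan_replicate_of_fixed r _ _ d (hr _ _ rfl)]
  simp only [scan_cons]
  rw [hr _ _ (rfl : retSpec k ([], cell anc false) = _)]
  simp only
  rw [scan_replicate_of_fixed r _ _ j (hr _ _ rfl)]
  simp [symCells, Function.comp_def]

/-- **Return into a fully gathered queue** (`k = m + 1` holes, the last hatted, nothing behind):
the reversed track of `seg (qbody d parked)` results. [cite: NishimuraOzawa2002, Lemma 5.1] -/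
theorem scan_ret_nil {r : List α × TSym α → List α × TSym α} {m : ℕ} (hr : Extends r (retSpec (m + 1)))
    (j k' d : ℕ) (parked : List α) (hpk : parked.length = m + 1) :
    scan r parked ((frees j ++ seg (List.replicate d dead ++ List.replicate (m + 1) hole ++ ([] : List α).map sym) ++ frees k').reverse) =
      ([], (frees j ++ seg (qbody d parked) ++ frees k').reverse) := by
  have hne : parked ≠ [] := by rintro rfl; simp at hpk
  obtain ⟨p', z, rfl⟩ : ∃ p' z, parked = p' ++ [z] := ⟨parked.dropLast, parked.getLast hne, (List.dropLast_append_getLast hne).symm⟩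
  have hm : p'.length = m := by simp at hpk; omega
  rw [seg_gathered_nil d m, seg_qbody_of_ne_nil d hne, annotSyms_append_singleton]
  simp only [List.reverse_append, List.reverse_cons, List.reverse_replicate, List.append_assoc,
    List.nil_append, symCells_append, symCells_cons, symCells_nil, List.cons_append]
  rw [scan_append, scan_replicate_of_fixed r _ _ k' (hr _ _ rfl)]
  simp only [scan_cons]
  have hpk1 : p'.length + 1 ≤ m + 1 := by omega
  rw [hr _ _ (by simp [retSpec, List.getLast?_append, hpk1] :
    retSpec (m + 1) (p' ++ [z], cell hole true) = some (p', cell (sym z) true))]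
  simp only
  have hholes := scan_ret_holes hr p' (by omega)
  rw [hm] at hholes
  rw [scan_append, hholes]
  simp only
  rw [scan_append, scan_replicate_of_fixed r _ _ d (hr _ _ rfl)]
  simp only [scan_cons]
  rw [hr _ _ (rfl : retSpec (m + 1) ([], cell anc false) = _)]
  simp only
  rw [scan_replicate_of_fixed r _ _ j (hr _ _ rfl)]
  simp [symCells, Function.comp_def]

/-! ### Lifting a track rule to cells and registers with more components -/

section Lift

variable {Φ₁ Φ₂ C₁ C₂ : Type}

/-- **Scan of a lifted rule.** If on the states in the image of `f` the cell rule `r₂` acts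
through the track rule `r₁` — reading the track with `get`, writing it with `set`, and moving
the register along `f` — then scanning with `r₂` from `f φ` is the lift of scanning the track
contents with `r₁` from `φ` (the other components of the cells ride along in `set`). [folklore] -/
theorem scan_lift (r₁ : Φ₁ × C₁ → Φ₁ × C₁) (r₂ : Φ₂ × C₂ → Φ₂ × C₂) (f : Φ₁ → Φ₂)
    (get : C₂ → C₁) (set : C₂ → C₁ → C₂)
    (h : ∀ φ c, r₂ (f φ, c) = (f (r₁ (φ, get c)).1, set c (r₁ (φ, get c)).2))
    (φ : Φ₁) (cs : List C₂) :
    scan r₂ (f φ) cs =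
      (f (scan r₁ φ (cs.map get)).1, List.zipWith set cs (scan r₁ φ (cs.map get)).2) := by
  induction cs generalizing φ with
  | nil => rfl
  | cons c cs ih => simp [scan_cons, h, ih]

/-- The same, when the lifted rule is only known to act through `r₁` on the cells actually met
(a hypothesis restricted to the list). [folklore] -/
theorem scan_lift_of_forall_mem (r₁ : Φ₁ × C₁ → Φ₁ × C₁) (r₂ : Φ₂ × C₂ → Φ₂ × C₂) (f : Φ₁ → Φ₂)
    (get : C₂ → C₁) (set : C₂ → C₁ → C₂) (cs : List C₂)
    (h : ∀ φ, ∀ c ∈ cs, r₂ (f φ, c) = (f (r₁ (φ, get c)).1, set c (r₁ (φ, get c)).2)) (φ : Φ₁) :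
    scan r₂ (f φ) cs =
      (f (scan r₁ φ (cs.map get)).1, List.zipWith set cs (scan r₁ φ (cs.map get)).2) := by
  induction cs generalizing φ with
  | nil => rfl
  | cons c cs ih =>
    have hc := h φ c (by simp)
    have ih' := ih (fun ψ c' hc' => h ψ c' (by simp [hc']))
    simp [scan_cons, hc, ih']

end Lift

end Track

end QTM

end Literature.Computability.Cryptography
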